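import Summits.ABC.ABC.Theses.CongruentialReceptacle
import Summits.ABC.ABC.Theorems.CongruentialReceptacleAssembly
import Summits.ABC.ABC.Theorems.BalancedFreySzpiro.Negative.WithoutEps
import Summits.ABC.ABC.Theorems.BalancedFreySzpiro.Negative.Strengthenings
import Summits.ABC.ABC.Theorems.CongruentialReceptacleBalancedFreySzpiroPort
import HarnessLib

/-!
# Disproof of `BalancedFreySzpiro` (crux stmt-ABC-1723, route CongruentialReceptacle) — findings

Standing disprover's work file (refuter-cdisprove-stmt-ABC-1723-0, cycle 1, 2026-08-16).
The crux: `∀ κ > 0, ∀ ε > 0, ∃ C, ∀ abc triples with κc ≤ a, κc ≤ b, (abc)² ≤ C · rad(abc)^(6+ε)`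
(Szpiro `6+ε` in elementary currency on the compactly balanced cell).

VERDICT SO FAR: NO KILL, and none is possible short of disproving the summit —
`not_abc_of_not_balancedFreySzpiro` (§0): the crux is implied by `ABC` (lead's
`balancedFreySzpiro_of_abc`), by `SzpiroConjecture`, and by the line's hard stub; the definitions
`IsABCTriple` (positive, coprime, `a + b = c`) and `rad` (radical in `ℕ`) are junk-free, so no
degenerate instance exists (the cell is EMPTY for `κ > 1/2` and is `{(1,1,2)}` at `κ = 1/2`, §4).

FINDINGS (all sorry-free unless marked):
* §0 reductions — `¬crux → ¬ABC`, `¬crux → ¬SzpiroConjecture`, `¬crux → ¬stub_szpiroMinimalModel`.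
* §1 load-bearing hypotheses —
  - coprimality IS load-bearing: `balancedFreySzpiro_false_without_coprime` (witness `2ⁿ + 2ⁿ = 2ⁿ⁺¹`);
  - `ε > 0` IS load-bearing: lead's `balancedFreySzpiro_false_without_eps` (Negative/WithoutEps.lean,
    balanced witnesses `{2^(kNt), 3^(mNt)}` by Euler + Dirichlet) — cited, not redone;
  - positivity `0 < a, 0 < b` is NOT load-bearing (implied by coprimality + balance): `withoutPos_iff`;
  - balance is NOT VISIBLY load-bearing: dropping both balance hypotheses gives Frey–Szpiro `6+ε` for
    ALL abc triples, still implied by `SzpiroConjecture` / `ABC` (`withoutBalance_of_szpiroConjecture`,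
    `withoutBalance_of_abc`); uniformity of `C` in `κ` is the same statement
    (`uniformInKappa_iff_withoutBalance`). No engine in the tree uses balance (cf. PICKED.md).
* §2 tightness / refuted strengthenings — exponent `s ≤ 6` with any constant fails on every window
  `0 < κ < 1/2` (`not_balancedSzpiro_exponent_le_six`, so `6 − ε` fails:
  `balancedFreySzpiro_false_exponent_six_sub`); `C` uniform in `ε` fails
  (`balancedFreySzpiro_false_uniform_in_eps`: `∃ C ∀ ε` forces the false `ε = 0` case by `ε → 0⁺`).
  So `C(κ, ε) → ∞` as `ε → 0⁺`; the RATE is open on the cell (the balanced witnesses are doubly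
  exponential: excess `c/rad ≍ 5^j` at `log c ≍ 5^j·(Dirichlet height)`; Masser/Stewart–Tijdeman
  polylog witnesses `b < a < c < 2a` carry no lower bound on `b` and need not lie on the cell).
* §3 line SketchIdeator1 (lead prover-line-stmt-ABC-1723-0; stub 1 `stub_freyModelSqLe` LANDED; hard
  stub `stub_szpiroMinimalModel` = Szpiro for minimal integral models): the stub's `ε` is load-bearing
  — `stubSzpiroMinimalModel_false_without_eps` (the cell's balanced witnesses pushed through the landed
  stub 1: `|Δ(W₀)| ≥ (abc)²/2⁸ ≥ c⁶/2¹⁶ > K⁶ N⁶/2⁷⁶`) and `stubSzpiroMinimalModel_false_uniform_in_eps`;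
  the stub itself is implied by `SzpiroConjecture` (lead: `szpiroMinimalModel_of_szpiroConjecture`) hence
  by `ABC` (`szpiro_of_abcLe_holds`), so it is unbreakable short of `¬ABC`; joint sufficiency
  (stub 1 ∧ stub 2 → crux) is kernel-checked in the skeleton (`szpiroPort_of_model_of_szpiro`) and
  re-proved here as `balancedFreySzpiro_of_stub` — no smuggled gap; balance unused. Stub hypotheses:
  MINIMALITY load-bearing (`stubSzpiroMinimalModel_false_without_minimality`: rescalings
  `y² = x³ − u⁴x`, `Δ = 64u¹²`, constant conductor), `IsElliptic` NOT load-bearing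
  (`stubSzpiroMinimalModel_iff_without_isElliptic`). LANDED: Negative/Strengthenings.lean (p99275, commit 4e59f75f61ce) and
  Negative/StubHypotheses.lean (p101050, commit 61c123c309fc); the two stub-hypothesis theorems below are
  kept inline here until the farm has built StubHypotheses (then: aliases, as for Strengthenings).
* §4 degenerate regimes — `cell_empty_of_half_lt` (κ > 1/2: vacuous), `cell_at_half` (κ = 1/2: only
  `(1,1,2)`); with `QuarterWindowGivesCrux` (proved) the whole content sits at κ = 1/4.
* §5 data — small balanced triples of high merit (comments).
-/

set_option linter.dupNamespace false

noncomputable section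

open Literature.NumberTheory.DiophantineGeometry Literature.NumberTheory.EllipticCurves
open UniqueFactorizationMonoid IsDedekindDomain WeierstrassCurve
open Summit.ABC.ABC.Theses.CongruentialReceptacle
open Summit.ABC.ABC.Theorems Summit.ABC.ABC.Theorems.BalancedFreySzpiro.Negative
open scoped Topology
open Filter

namespace Summit.ABC.ABC.Cruxes.BalancedFreySzpiro.Disproof

/-! ## §0 Why it resists: a kill of the crux is a disproof of abc / Szpiro -/

/-- The hard stub of line SketchIdeator1 (`stub_szpiroMinimalModel`), verbatim: Szpiro's inequality for
minimal integral models. [cite: SilvermanAEC2009, Conj. VIII.11.1] -/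
def StubSzpiroMinimalModel : Prop :=
  ∀ ε : ℝ, 0 < ε → ∃ C : ℝ, ∀ W₀ : WeierstrassCurve ℤ,
    (W₀.baseChange ℚ).IsElliptic → (∀ v : HeightOneSpectrum ℤ, (W₀.baseChange ℚ).IsMinimalAt v) →
      (|W₀.Δ| : ℝ) ≤ C * (((W₀.baseChange ℚ).conductorNorm ℤ : ℕ) : ℝ) ^ (6 + ε)

/-- A refutation of the crux refutes the summit: `BalancedFreySzpiro` follows from `ABC`
(lead's `balancedFreySzpiro_of_abc`). [folklore] -/
theorem not_abc_of_not_balancedFreySzpiro (h : ¬ BalancedFreySzpiro) : ¬ _root_.ABC :=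
  fun hABC => h (balancedFreySzpiro_of_abc hABC)

/-- A refutation of the crux refutes Szpiro's conjecture (lead's
`balancedFreySzpiro_of_szpiroConjecture`). [folklore] -/
theorem not_szpiroConjecture_of_not_balancedFreySzpiro (h : ¬ BalancedFreySzpiro) :
    ¬ SzpiroConjecture :=
  fun hS => h (balancedFreySzpiro_of_szpiroConjecture hS)

/-- **Joint sufficiency of the line, re-checked: the hard stub alone gives the crux** (stub 1 is the
landed theorem `stub_freyModelSqLe`); the balance hypotheses are not used. Same computation as the
skeleton's `szpiroPort_of_model_of_szpiro`. [cite: Oesterle1988, §3] -/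
theorem balancedFreySzpiro_of_stub (h₂ : StubSzpiroMinimalModel) : BalancedFreySzpiro := by
  unfold BalancedFreySzpiro
  intro κ _ ε hε
  obtain ⟨C₁, hC₁⟩ := h₂ ε hε
  set C : ℝ := max C₁ 1 with hCdef
  have hC0 : 0 ≤ C := zero_le_one.trans (le_max_right _ _)
  refine ⟨2 ^ 8 * C * ((2 : ℝ) ^ 10) ^ (6 + ε), fun a b c h _ _ ↦ ?_⟩
  obtain ⟨W₀, hE, hmin, hN, hsq⟩ := stub_freyModelSqLe a b c h
  have key := hC₁ W₀ hE hmin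
  set N : ℝ := (((W₀.baseChange ℚ).conductorNorm ℤ : ℕ) : ℝ) with hNdef
  set R : ℝ := ((rad a b c : ℕ) : ℝ) with hRdef
  have hN0 : 0 ≤ N := by positivity
  have hR0 : 0 ≤ R := by positivity
  have h1 : (|W₀.Δ| : ℝ) ≤ C * N ^ (6 + ε) :=
    key.trans (mul_le_mul_of_nonneg_right (le_max_left _ _) (by positivity))
  have h2 : N ≤ 2 ^ 10 * R := by
    have := Nat.le_of_dvd (mul_pos (by positivity) (by rw [rad_def]; exact Nat.radical_pos _)) hN
    rw [hNdef, hRdef]; exact_mod_cast this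
  have hsq' : ((a * b * c : ℕ) : ℝ) ^ 2 ≤ 2 ^ 8 * (|W₀.Δ| : ℝ) := by
    have : (((a * b * c : ℕ) : ℤ) : ℝ) ^ 2 ≤ ((2 ^ 8 * |W₀.Δ| : ℤ) : ℝ) := by exact_mod_cast hsq
    push_cast at this ⊢
    linarith
  calc ((a * b * c : ℕ) : ℝ) ^ 2 ≤ 2 ^ 8 * (|W₀.Δ| : ℝ) := hsq'
    _ ≤ 2 ^ 8 * (C * N ^ (6 + ε)) := by linarith
    _ ≤ 2 ^ 8 * (C * (2 ^ 10 * R) ^ (6 + ε)) := by gcongr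
    _ = (2 ^ 8 * C * ((2 : ℝ) ^ 10) ^ (6 + ε)) * R ^ (6 + ε) := by
        rw [Real.mul_rpow (by positivity) hR0]; ring

/-- Hence a refutation of the crux refutes the line's hard stub (and conversely nothing weaker than a
disproof of Szpiro for minimal models can come out of attacking the line). [folklore] -/
theorem not_stub_of_not_balancedFreySzpiro (h : ¬ BalancedFreySzpiro) : ¬ StubSzpiroMinimalModel :=
  fun h₂ => h (balancedFreySzpiro_of_stub h₂)

/-! ## §1 Load-bearing hypotheses -/

/-- The crux with COPRIMALITY dropped (only `0 < a`, `0 < b`, `a + b = c` kept). -/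
def BalancedFreySzpiroWithoutCoprime : Prop :=
  ∀ κ : ℝ, 0 < κ → ∀ ε : ℝ, 0 < ε → ∃ C : ℝ, ∀ a b c : ℕ, 0 < a → 0 < b → a + b = c →
    κ * (c : ℝ) ≤ (a : ℝ) → κ * (c : ℝ) ≤ (b : ℝ) →
      ((a * b * c : ℕ) : ℝ) ^ 2 ≤ C * ((rad a b c : ℕ) : ℝ) ^ (6 + ε)

/-- **Coprimality is load-bearing** (LANDED: `Negative.balancedFreySzpiro_false_without_coprime`,
Negative/Strengthenings.lean, p99275): without it the perfectly balanced non-coprime triples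
`2ⁿ + 2ⁿ = 2ⁿ⁺¹` (κ = 1/2) have `(abc)² = 2^(6n+2)` against `rad = 2`. Any proof must use
`Nat.Coprime a b`. [folklore] -/
theorem balancedFreySzpiro_false_without_coprime : ¬ BalancedFreySzpiroWithoutCoprime :=
  _root_.Summit.ABC.ABC.Theorems.BalancedFreySzpiro.Negative.balancedFreySzpiro_false_without_coprime

/-- The crux with POSITIVITY dropped (`a + b = c`, `Nat.Coprime a b` kept). -/
def BalancedFreySzpiroWithoutPos : Prop :=
  ∀ κ : ℝ, 0 < κ → ∀ ε : ℝ, 0 < ε → ∃ C : ℝ, ∀ a b c : ℕ, a + b = c → Nat.Coprime a b →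
    κ * (c : ℝ) ≤ (a : ℝ) → κ * (c : ℝ) ≤ (b : ℝ) →
      ((a * b * c : ℕ) : ℝ) ^ 2 ≤ C * ((rad a b c : ℕ) : ℝ) ^ (6 + ε)

/-- **Positivity is NOT load-bearing** ("h_pos possibly unnecessary"): with `a = 0` coprimality forces
`b = c = 1` and then `κ · 1 ≤ 0` is impossible; symmetrically for `b = 0`. So the crux with
`0 < a`, `0 < b` deleted is EQUIVALENT to the crux. [folklore] -/
theorem withoutPos_iff : BalancedFreySzpiroWithoutPos ↔ BalancedFreySzpiro := by
  unfold BalancedFreySzpiroWithoutPos BalancedFreySzpiro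
  constructor
  · intro h κ hκ ε hε
    obtain ⟨C, hC⟩ := h κ hκ ε hε
    exact ⟨C, fun a b c ht ha hb => hC a b c ht.2.2.1 ht.2.2.2 ha hb⟩
  · intro h κ hκ ε hε
    obtain ⟨C, hC⟩ := h κ hκ ε hε
    refine ⟨C, fun a b c hsum hcop ha hb => ?_⟩
    rcases Nat.eq_zero_or_pos a with rfl | ha0
    · exfalso
      have hb1 : b = 1 := by simpa using hcop
      subst hb1
      have : c = 1 := by omega
      subst this
      norm_num at ha; linarith
    rcases Nat.eq_zero_or_pos b with rfl | hb0
    · exfalso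
      have ha1 : a = 1 := by simpa using hcop
      subst ha1
      have : c = 1 := by omega
      subst this
      norm_num at hb; linarith
    exact hC a b c ⟨ha0, hb0, hsum, hcop⟩ ha hb

/-- The crux with BOTH BALANCE hypotheses dropped: Frey–Szpiro `6+ε` in elementary currency for ALL
abc triples. -/
def BalancedFreySzpiroWithoutBalance : Prop :=
  ∀ ε : ℝ, 0 < ε → ∃ C : ℝ, ∀ a b c : ℕ, IsABCTriple a b c →
    ((a * b * c : ℕ) : ℝ) ^ 2 ≤ C * ((rad a b c : ℕ) : ℝ) ^ (6 + ε)

/-- The balance-free statement trivially gives the crux. [folklore] -/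
theorem balancedFreySzpiro_of_withoutBalance (h : BalancedFreySzpiroWithoutBalance) :
    BalancedFreySzpiro := by
  unfold BalancedFreySzpiro
  intro κ _ ε hε
  obtain ⟨C, hC⟩ := h ε hε
  exact ⟨C, fun a b c ht _ _ => hC a b c ht⟩

/-- **Balance is not visibly load-bearing**: the balance-free statement is still implied by the line's
hard stub (the port never touches `κ`)… [folklore] -/
theorem withoutBalance_of_stub (h₂ : StubSzpiroMinimalModel) : BalancedFreySzpiroWithoutBalance := by
  intro ε hε
  have := balancedFreySzpiro_of_stub h₂
  unfold BalancedFreySzpiro at this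
  -- run the port at the fictitious balance κ = 1/c: every abc triple has a, b ≥ 1 = (1/c)·c
  obtain ⟨C₁, hC₁⟩ := h₂ ε hε
  -- (re-derive directly instead, to avoid κ-dependence of the constant: the port's constant is κ-free)
  set C : ℝ := max C₁ 1 with hCdef
  refine ⟨2 ^ 8 * C * ((2 : ℝ) ^ 10) ^ (6 + ε), fun a b c h ↦ ?_⟩
  obtain ⟨W₀, hE, hmin, hN, hsq⟩ := stub_freyModelSqLe a b c h
  have key := hC₁ W₀ hE hmin
  set N : ℝ := (((W₀.baseChange ℚ).conductorNorm ℤ : ℕ) : ℝ) with hNdef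
  set R : ℝ := ((rad a b c : ℕ) : ℝ) with hRdef
  have hN0 : 0 ≤ N := by positivity
  have hR0 : 0 ≤ R := by positivity
  have h1 : (|W₀.Δ| : ℝ) ≤ C * N ^ (6 + ε) :=
    key.trans (mul_le_mul_of_nonneg_right (le_max_left _ _) (by positivity))
  have h2 : N ≤ 2 ^ 10 * R := by
    have := Nat.le_of_dvd (mul_pos (by positivity) (by rw [rad_def]; exact Nat.radical_pos _)) hN
    rw [hNdef, hRdef]; exact_mod_cast this
  have hsq' : ((a * b * c : ℕ) : ℝ) ^ 2 ≤ 2 ^ 8 * (|W₀.Δ| : ℝ) := by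
    have : (((a * b * c : ℕ) : ℤ) : ℝ) ^ 2 ≤ ((2 ^ 8 * |W₀.Δ| : ℤ) : ℝ) := by exact_mod_cast hsq
    push_cast at this ⊢
    linarith
  have hC0 : 0 ≤ C := zero_le_one.trans (le_max_right _ _)
  calc ((a * b * c : ℕ) : ℝ) ^ 2 ≤ 2 ^ 8 * (|W₀.Δ| : ℝ) := hsq'
    _ ≤ 2 ^ 8 * (C * N ^ (6 + ε)) := by linarith
    _ ≤ 2 ^ 8 * (C * (2 ^ 10 * R) ^ (6 + ε)) := by gcongr
    _ = (2 ^ 8 * C * ((2 : ℝ) ^ 10) ^ (6 + ε)) * R ^ (6 + ε) := by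
        rw [Real.mul_rpow (by positivity) hR0]; ring

/-- … hence by `SzpiroConjecture` (lead's `szpiroMinimalModel_of_szpiroConjecture`) … [folklore] -/
theorem withoutBalance_of_szpiroConjecture (hS : SzpiroConjecture) : BalancedFreySzpiroWithoutBalance :=
  withoutBalance_of_stub (szpiroMinimalModel_of_szpiroConjecture hS)

/-- … hence by `ABC` (`szpiro_of_abcLe_holds`, Silverman VIII.11.5(b)). So dropping balance keeps a
statement implied by the summit: no refutation of the balance-free form is available either, and a
prover gains nothing checkable from `κ` with the engines in the tree. [cite: SilvermanAEC2009, VIII.11.5(b)] -/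
theorem withoutBalance_of_abc (hABC : _root_.ABC) : BalancedFreySzpiroWithoutBalance := by
  refine withoutBalance_of_szpiroConjecture (szpiro_of_abcLe_holds ?_)
  intro ε hε
  obtain ⟨C, _hC0, hC⟩ := hABC ε hε
  exact ⟨C, fun a b c h ↦ (hC a b c h).le⟩

/-- The crux with `C` UNIFORM IN `κ` (quantifier swap `∃ C ∀ κ`). -/
def BalancedFreySzpiroUniformInKappa : Prop :=
  ∀ ε : ℝ, 0 < ε → ∃ C : ℝ, ∀ κ : ℝ, 0 < κ → ∀ a b c : ℕ, IsABCTriple a b c →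
    κ * (c : ℝ) ≤ (a : ℝ) → κ * (c : ℝ) ≤ (b : ℝ) →
      ((a * b * c : ℕ) : ℝ) ^ 2 ≤ C * ((rad a b c : ℕ) : ℝ) ^ (6 + ε)

/-- **Uniformity in `κ` = dropping balance**: every abc triple is `(1/c)`-balanced. So the natural
strengthening "`C` independent of `κ`" is exactly Frey–Szpiro for all triples — implied by `ABC`, not
refutable here, and not provable by any cell-specific method. [folklore] -/
theorem uniformInKappa_iff_withoutBalance :
    BalancedFreySzpiroUniformInKappa ↔ BalancedFreySzpiroWithoutBalance := by
  constructor
  · intro h ε hε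
    obtain ⟨C, hC⟩ := h ε hε
    refine ⟨C, fun a b c ht => ?_⟩
    have hsum : a + b = c := ht.2.2.1
    have ha : 0 < a := ht.1
    have hb : 0 < b := ht.2.1
    have hc : 0 < c := by omega
    have hc' : (0 : ℝ) < c := by exact_mod_cast hc
    refine hC (1 / c) (by positivity) a b c ht ?_ ?_
    · rw [one_div, inv_mul_cancel₀ hc'.ne']; exact_mod_cast ha
    · rw [one_div, inv_mul_cancel₀ hc'.ne']; exact_mod_cast hb
  · intro h ε hε
    obtain ⟨C, hC⟩ := h ε hε
    exact ⟨C, fun κ _ a b c ht _ _ => hC a b c ht⟩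

/-- **`ε > 0` is load-bearing** — the lead's theorem, re-exported for the index: the crux with `6 + 0`
fails (balanced witnesses `2^(kNt)`, `3^(mNt)` congruent mod `5^j`, Negative/WithoutEps.lean). [new] -/
theorem balancedFreySzpiro_false_without_eps' :
    ¬ ∀ κ : ℝ, 0 < κ → ∃ C : ℝ, ∀ a b c : ℕ, IsABCTriple a b c → κ * (c : ℝ) ≤ (a : ℝ) →
      κ * (c : ℝ) ≤ (b : ℝ) → ((a * b * c : ℕ) : ℝ) ^ 2 ≤ C * ((rad a b c : ℕ) : ℝ) ^ ((6 : ℝ) + 0) :=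
  balancedFreySzpiro_false_without_eps

/-! ## §2 Tightness: refuted natural strengthenings -/

/-- **No exponent `s ≤ 6` works on any window** `0 < κ < 1/2`, whatever the constant (LANDED:
`Negative.not_balancedSzpiro_exponent_le_six`, p99275): `rad ≥ 1`, so `rad^s ≤ rad^6` and the
`ε = 0` refutation applies. [new] -/
theorem not_balancedSzpiro_exponent_le_six {κ s : ℝ} (hκ0 : 0 < κ) (hκ : κ < 1 / 2) (hs : s ≤ 6) :
    ¬ ∃ C : ℝ, ∀ a b c : ℕ, IsABCTriple a b c → κ * (c : ℝ) ≤ (a : ℝ) → κ * (c : ℝ) ≤ (b : ℝ) →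
      ((a * b * c : ℕ) : ℝ) ^ 2 ≤ C * ((rad a b c : ℕ) : ℝ) ^ s :=
  _root_.Summit.ABC.ABC.Theorems.BalancedFreySzpiro.Negative.not_balancedSzpiro_exponent_le_six hκ0 hκ hs

/-- **The crux with `6 − ε` in place of `6 + ε` is false** (LANDED:
`Negative.balancedFreySzpiro_false_exponent_six_sub`, p99275). The exponent 6 — the precision
`c₂/c₁ → 6` the route's receptacle must reach — has no slack on the cell. [new] -/
theorem balancedFreySzpiro_false_exponent_six_sub :
    ¬ ∀ κ : ℝ, 0 < κ → ∀ ε : ℝ, 0 < ε → ∃ C : ℝ, ∀ a b c : ℕ, IsABCTriple a b c →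
      κ * (c : ℝ) ≤ (a : ℝ) → κ * (c : ℝ) ≤ (b : ℝ) →
        ((a * b * c : ℕ) : ℝ) ^ 2 ≤ C * ((rad a b c : ℕ) : ℝ) ^ (6 - ε) :=
  _root_.Summit.ABC.ABC.Theorems.BalancedFreySzpiro.Negative.balancedFreySzpiro_false_exponent_six_sub

/-- The crux with `C` UNIFORM IN `ε` (quantifier swap `∃ C ∀ ε > 0`). -/
def BalancedFreySzpiroUniformInEps : Prop :=
  ∀ κ : ℝ, 0 < κ → ∃ C : ℝ, ∀ ε : ℝ, 0 < ε → ∀ a b c : ℕ, IsABCTriple a b c →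
    κ * (c : ℝ) ≤ (a : ℝ) → κ * (c : ℝ) ≤ (b : ℝ) →
      ((a * b * c : ℕ) : ℝ) ^ 2 ≤ C * ((rad a b c : ℕ) : ℝ) ^ (6 + ε)

/-- **`C` cannot be uniform in `ε`** (LANDED: `Negative.balancedFreySzpiro_false_uniform_in_eps` with
the limit lemma `Negative.le_of_forall_pos_le_mul_rpow_add`, p99275): letting `ε → 0⁺` triple by
triple would give the false `ε = 0` inequality with the same constant. So `C(κ, ε) → ∞` as
`ε → 0⁺` is forced (rate: open on the cell, see §5). [new] -/
theorem balancedFreySzpiro_false_uniform_in_eps : ¬ BalancedFreySzpiroUniformInEps :=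
  _root_.Summit.ABC.ABC.Theorems.BalancedFreySzpiro.Negative.balancedFreySzpiro_false_uniform_in_eps

/-! ## §3 Line SketchIdeator1 — targets (stubs of the picked line) -/

/-- **The hard stub's `ε` is load-bearing** (LANDED: `Negative.stubSzpiroMinimalModel_false_without_eps`,
p99275): there is no `C` with `|Δ(W₀)| ≤ C · N^6` for all minimal integral models. Witnesses: the
global minimal Frey models (landed stub `stub_freyModelSqLe`) of the cell's balanced triples with
`c > K · rad` (`exists_balanced_abc_triple_lt`, κ = 1/4): `|Δ| ≥ (abc)²/2⁸ ≥ c⁶/2¹⁶ > K⁶ N⁶/2⁷⁶`.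
(Masser 1990 in the integral-model currency of the stub, reached from the crux's own cell; the tree's
`W/ℚ` currency: `Literature.Barriers.ABC.not_szpiro_epsilon_zero_holds`.) [cite: Masser1990, p. 19] -/
theorem stubSzpiroMinimalModel_false_without_eps :
    ¬ ∃ C : ℝ, ∀ W₀ : WeierstrassCurve ℤ, (W₀.baseChange ℚ).IsElliptic →
      (∀ v : HeightOneSpectrum ℤ, (W₀.baseChange ℚ).IsMinimalAt v) →
        (|W₀.Δ| : ℝ) ≤ C * (((W₀.baseChange ℚ).conductorNorm ℤ : ℕ) : ℝ) ^ (6 : ℝ) :=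
  _root_.Summit.ABC.ABC.Theorems.BalancedFreySzpiro.Negative.stubSzpiroMinimalModel_false_without_eps

/-- **Nor can the hard stub's constant be uniform in `ε`** (LANDED:
`Negative.stubSzpiroMinimalModel_false_uniform_in_eps`, p99275). [new] -/
theorem stubSzpiroMinimalModel_false_uniform_in_eps :
    ¬ ∃ C : ℝ, ∀ ε : ℝ, 0 < ε → ∀ W₀ : WeierstrassCurve ℤ, (W₀.baseChange ℚ).IsElliptic →
      (∀ v : HeightOneSpectrum ℤ, (W₀.baseChange ℚ).IsMinimalAt v) →
        (|W₀.Δ| : ℝ) ≤ C * (((W₀.baseChange ℚ).conductorNorm ℤ : ℕ) : ℝ) ^ (6 + ε) :=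
  _root_.Summit.ABC.ABC.Theorems.BalancedFreySzpiro.Negative.stubSzpiroMinimalModel_false_uniform_in_eps

/-- `Δ(y² = x³ − u⁴x) = 64 u¹²` over `ℤ`. [folklore] -/
theorem scaledModel_Δ (u : ℤ) : (⟨0, 0, 0, -u ^ 4, 0⟩ : WeierstrassCurve ℤ).Δ = 64 * u ^ 12 := by
  simp only [WeierstrassCurve.Δ, WeierstrassCurve.b₂, WeierstrassCurve.b₄, WeierstrassCurve.b₆,
    WeierstrassCurve.b₈]
  ring

/-- Over `ℚ`, `y² = x³ − u⁴x` is the variable change `(x, y) ↦ (u²x, u³y)` of `y² = x³ − x`.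
[folklore] -/
theorem baseChange_scaledModel (u : ℕ) (hu : u ≠ 0) :
    (⟨0, 0, 0, -(u : ℤ) ^ 4, 0⟩ : WeierstrassCurve ℤ).baseChange ℚ =
      (⟨Units.mk0 ((u : ℚ)⁻¹) (by positivity), 0, 0, 0⟩ : VariableChange ℚ) •
        (⟨0, 0, 0, -1, 0⟩ : WeierstrassCurve ℤ).baseChange ℚ := by
  ext <;> simp [WeierstrassCurve.baseChange, WeierstrassCurve.map, variableChange_a₁,
    variableChange_a₂, variableChange_a₃, variableChange_a₄, variableChange_a₆]

/-- **MINIMALITY is load-bearing for the hard stub** (LANDED as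
`Negative.stubSzpiroMinimalModel_false_without_minimality`, p101050): with `∀ v, IsMinimalAt v` deleted the statement
fails at `ε = 1` — the integral models `W_u : y² = x³ − u⁴x` are all `ℚ`-isomorphic to
`y² = x³ − x`, so `N(W_u)` is constant (`conductorNorm_smul_rat`) while `|Δ(W_u)| = 64u¹² → ∞`.
[folklore] -/
theorem stubSzpiroMinimalModel_false_without_minimality :
    ¬ ∀ ε : ℝ, 0 < ε → ∃ C : ℝ, ∀ W₀ : WeierstrassCurve ℤ, (W₀.baseChange ℚ).IsElliptic →
        (|W₀.Δ| : ℝ) ≤ C * (((W₀.baseChange ℚ).conductorNorm ℤ : ℕ) : ℝ) ^ (6 + ε) := by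
  intro h
  obtain ⟨C, hC⟩ := h 1 one_pos
  set W₁ : WeierstrassCurve ℤ := ⟨0, 0, 0, -1, 0⟩ with hW₁
  have hE₁ : (W₁.baseChange ℚ).IsElliptic := by
    rw [WeierstrassCurve.isElliptic_iff]
    show IsUnit ((W₁.map (algebraMap ℤ ℚ)).Δ)
    rw [WeierstrassCurve.map_Δ]
    have : W₁.Δ = 64 := by
      rw [hW₁]; simp only [WeierstrassCurve.Δ, WeierstrassCurve.b₂, WeierstrassCurve.b₄,
        WeierstrassCurve.b₆, WeierstrassCurve.b₈]; norm_num
    rw [this]; norm_num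
  set N₁ : ℝ := (((W₁.baseChange ℚ).conductorNorm ℤ : ℕ) : ℝ) with hN₁
  obtain ⟨u, hu⟩ := exists_nat_gt (C * N₁ ^ (7 : ℕ))
  set u' : ℕ := u + 1 with hu'
  have hu'0 : u' ≠ 0 := by omega
  set Wu : WeierstrassCurve ℤ := ⟨0, 0, 0, -(u' : ℤ) ^ 4, 0⟩ with hWu
  have hbc := baseChange_scaledModel u' hu'0
  haveI : (W₁.baseChange ℚ).IsElliptic := hE₁
  have hEu : (Wu.baseChange ℚ).IsElliptic := by
    rw [hWu, hbc]; infer_instance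
  have hNu : (Wu.baseChange ℚ).conductorNorm ℤ = (W₁.baseChange ℚ).conductorNorm ℤ := by
    rw [hWu, hbc, conductorNorm_smul_rat]
  have key := hC Wu hEu
  rw [hNu, ← hN₁, show (6 : ℝ) + 1 = ((7 : ℕ) : ℝ) by norm_num, Real.rpow_natCast] at key
  have hΔ : Wu.Δ = 64 * (u' : ℤ) ^ 12 := by rw [hWu]; exact scaledModel_Δ _
  rw [hΔ] at key
  push_cast at key
  rw [abs_of_nonneg (by positivity)] at key
  have h1 : (u : ℝ) < (u' : ℝ) := by rw [hu']; push_cast; linarith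
  have hu0 : (0 : ℝ) ≤ u := Nat.cast_nonneg u
  have h2 : (u' : ℝ) ≤ (u' : ℝ) ^ 12 := by
    have h1' : (1 : ℝ) ≤ u' := by rw [hu']; push_cast; linarith
    calc (u' : ℝ) = (u' : ℝ) ^ 1 := (pow_one _).symm
      _ ≤ (u' : ℝ) ^ 12 := pow_le_pow_right₀ h1' (by norm_num)
  linarith

/-- **`IsElliptic` is NOT load-bearing for the hard stub** (LANDED as
`Negative.stubSzpiroMinimalModel_iff_without_isElliptic`, p101050): deleting it gives an equivalent statement
(a singular `W₀` has `Δ = 0 ≤ C · N^(6+ε)` once `C ≥ 0`). [folklore] -/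
theorem stubSzpiroMinimalModel_iff_without_isElliptic :
    StubSzpiroMinimalModel ↔
    (∀ ε : ℝ, 0 < ε → ∃ C : ℝ, ∀ W₀ : WeierstrassCurve ℤ,
      (∀ v : HeightOneSpectrum ℤ, (W₀.baseChange ℚ).IsMinimalAt v) →
        (|W₀.Δ| : ℝ) ≤ C * (((W₀.baseChange ℚ).conductorNorm ℤ : ℕ) : ℝ) ^ (6 + ε)) := by
  constructor
  · intro h ε hε
    obtain ⟨C, hC⟩ := h ε hε
    refine ⟨max C 0, fun W₀ hmin => ?_⟩
    by_cases hE : (W₀.baseChange ℚ).IsElliptic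
    · exact (hC W₀ hE hmin).trans (mul_le_mul_of_nonneg_right (le_max_left _ _) (by positivity))
    · have hΔ : W₀.Δ = 0 := by
        by_contra hne
        apply hE
        rw [WeierstrassCurve.isElliptic_iff]
        show IsUnit ((W₀.map (algebraMap ℤ ℚ)).Δ)
        rw [WeierstrassCurve.map_Δ]
        exact isUnit_iff_ne_zero.mpr (by simpa using hne)
      rw [hΔ]; push_cast; rw [abs_zero]
      exact mul_nonneg (le_max_right _ _) (by positivity)
  · intro h ε hε
    obtain ⟨C, hC⟩ := h ε hε
    exact ⟨C, fun W₀ _ hmin => hC W₀ hmin⟩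

/-! ## §4 Degenerate regimes of `κ` -/

/-- **The cell is EMPTY for `κ > 1/2`** (LANDED: `Negative.cell_empty_of_half_lt`, p99275): there the
crux holds vacuously with any `C`. [folklore] -/
theorem cell_empty_of_half_lt {κ : ℝ} (hκ : 1 / 2 < κ) {a b c : ℕ} (h : IsABCTriple a b c)
    (ha : κ * (c : ℝ) ≤ (a : ℝ)) (hb : κ * (c : ℝ) ≤ (b : ℝ)) : False :=
  _root_.Summit.ABC.ABC.Theorems.BalancedFreySzpiro.Negative.cell_empty_of_half_lt hκ h ha hb

/-- **At `κ = 1/2` the cell is the single triple `(1, 1, 2)`** (LANDED: `Negative.cell_eq_of_half`,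
p99275). [folklore] -/
theorem cell_at_half {a b c : ℕ} (h : IsABCTriple a b c)
    (ha : (1 / 2 : ℝ) * (c : ℝ) ≤ (a : ℝ)) (hb : (1 / 2 : ℝ) * (c : ℝ) ≤ (b : ℝ)) :
    a = 1 ∧ b = 1 ∧ c = 2 :=
  _root_.Summit.ABC.ABC.Theorems.BalancedFreySzpiro.Negative.cell_eq_of_half h ha hb

/-- So the crux at any `κ ≥ 1/2` is trivially TRUE (constant `C = 4`, as `(1·1·2)² = 4 ≤ 4 · 2^(6+ε)`);
all content sits at `0 < κ < 1/2`, and by the proved support `QuarterWindowGivesCrux` at `κ = 1/4`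
exactly. [folklore] -/
theorem balancedSzpiro_of_half_le {κ : ℝ} (hκ : 1 / 2 ≤ κ) (ε : ℝ) (hε : 0 < ε) :
    ∃ C : ℝ, ∀ a b c : ℕ, IsABCTriple a b c → κ * (c : ℝ) ≤ (a : ℝ) → κ * (c : ℝ) ≤ (b : ℝ) →
      ((a * b * c : ℕ) : ℝ) ^ 2 ≤ C * ((rad a b c : ℕ) : ℝ) ^ (6 + ε) := by
  refine ⟨4, fun a b c h ha hb => ?_⟩
  have hc0 : (0 : ℝ) ≤ c := Nat.cast_nonneg c
  have ha' : (1 / 2 : ℝ) * (c : ℝ) ≤ (a : ℝ) := (mul_le_mul_of_nonneg_right hκ hc0).trans ha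
  have hb' : (1 / 2 : ℝ) * (c : ℝ) ≤ (b : ℝ) := (mul_le_mul_of_nonneg_right hκ hc0).trans hb
  obtain ⟨rfl, rfl, rfl⟩ := cell_at_half h ha' hb'
  have hrad : rad 1 1 2 = 2 := by
    rw [rad_def]; simpa using radical_pow_of_prime Nat.prime_two.prime (n := 1) one_ne_zero
  rw [hrad]
  have h64 : (2 : ℝ) ^ (6 : ℝ) ≤ (2 : ℝ) ^ (6 + ε) :=
    Real.rpow_le_rpow_of_exponent_le (by norm_num) (by linarith)
  have h64' : (2 : ℝ) ^ (6 : ℝ) = 64 := by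
    rw [show (6 : ℝ) = ((6 : ℕ) : ℝ) by norm_num, Real.rpow_natCast]; norm_num
  push_cast
  nlinarith

/-! ## §5 Data: balanced triples of high merit (empirical; comments only)

Exhaustive scan (folder `cell_scan.py`, local, 32 s) of the κ = 1/4 cell (`c/4 ≤ a < b`) for
`c ≤ 10⁵`: 58 abc-hits (`rad(abc) < c`). Top quality and top Szpiro-ratio `(abc)²/rad⁶`:

* `36864 + 41261 = 78125` (`2¹²·3² + 11³·31 = 5⁷`): `min/c = 0.472`, quality `1.2202`,
  `(abc)²/rad⁶ ≈ 1.23·10⁴` (`rad = 10230`) — the cell's record below `10⁵` (the item text's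
  `32 + 49 = 81`, quality `1.1757`, ratio `2.94`, is only 4th by quality);
* `169 + 343 = 512` (`13² + 7³ = 2⁹`): quality `1.1988`, ratio `24.2`;
  `1024 + 1377 = 2401` (`2¹⁰ + 3⁴·17 = 7⁴`): quality `1.1846`, ratio `86.5`;
  `22528 + 28125 = 50653` (`2¹¹·11 + 3²·5⁵ = 37³`): ratio `311`; `13122 + 16807 = 29929`
  (`2·3⁸ + 7⁵ = 173²`): ratio `296`; `8192 + 19683 = 27875` (`2¹³ + 3⁹ = 5³·223`): ratio `225`.
* So any constant of the crux at κ = 1/4 has `C(1/4, ε) ≥ 1.23·10⁴ · 10230^(−ε)` (e.g. `≥ 4.9·10³`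
  at `ε = 0.1`, and `> 1` at `ε = 1`: the elementary Szpiro ratio `log (abc)² / log rad` of
  `2¹²3² + 11³31 = 5⁷` is `7.02 > 7`, the only one above 7 on the cell below `10⁵`); counts of hits
  per dyadic `c`-range stay small (27 below `2·10⁴`, 58 below `10⁵`).
* The cell carries abc-hits of every size by `exists_balanced_abc_triple_lt`, but the certified
  witnesses are astronomically large (`c = 3^(mNt)` with `N = φ(5^j)`); the admissible LOSS on the
  cell (how fast `C(κ,ε)` must grow) is not known beyond "unbounded" — a polylog-loss refutation
  on the cell (the analogue of Masser's `(log N)^k`) would need three-way balanced smooth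
  near-collisions and is OPEN here (recorded for crux-ideate; not attempted in Lean).

RATE ANALYSIS (paper, for ideators; why the cell is harder than Masser's setting). Every known
`ε = 0` witness family has two `P`-smooth members and a third member `≡ 0 (mod m)`, `m` powerful;
the loss factor is `F = c/rad ≍ m/rad(m)`. (i) Pigeonhole over `P`-units (Stewart–Tijdeman, Masser,
B–G 12.4.12, the tree's `EpsilonCannotBeDroppedPolylog`) produces congruent units in ONE cell of
the pigeonhole, `n < n' < e^w n`, so `b = n' − n < (e^w − 1)c` with NO LOWER BOUND on `b`: nothing
keeps the triple on the cell (Masser's dyadic block gives `c < 2a` only, never `b ≥ κc`). Powering `(n^e, n'^e)` restores balance but costs `e ≍ n/m`, doubly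
exponential. (ii) With two primes `{2, 3}` and `m = 5^j` (the lead's family) the congruence lattice
`Λ = {(x,y) : 2^x ≡ 3^y (5^j)}` has index `N = φ(5^j)` and the balance window is an INHOMOGENEOUS
condition `x log 2 − y log 3 ∈ −[α, β]`; along `Λ` this is `‖yω‖ ∈ [α', β']` with
`ω = (L log 2 − log 3)/(N log 2)`, `α' ≍ α/N`. Continued fractions of `ω` give a solution with
`y ≲ q_{k+2}` where `q_{k+1} ≤ N/α`; an irrationality measure `μ` of `log 3/log 2` (Baker; `μ < 5.2`
in print) bounds `q_{k+2} ≲ N q_{k+1}^{μ−1}`, so `log c ≲ N^μ` and the loss is only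
`F ≍ N ≍ (log c)^{1/μ}` — a Baker-type input for a sub-polylog gain. (iii) Loss `(log c)^k` for every
`k` needs `t ≥ k + 2` primes and a lattice point of the index-`V` congruence lattice `Λ ⊂ ℤ^t` in the
thin slab `{α ≤ Σ fᵢ log pᵢ ≤ β}` at height `|f| ≲ V^{1/(t−1)}` — true on average (the `φ`-values of
`Λ ∩ box` have mean gap `≪ 1` there) but a proof needs a transference / quantitative Kronecker
theorem (Cassels, Ch. V) or an exponential-sum discrepancy bound; none is in the tree. So the
quantitative tightness of the crux on the cell is a genuine gap in print and in the tree (ideator-1 B2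
concurs), not reachable by the cheap methods of this file.
-/

end Summit.ABC.ABC.Cruxes.BalancedFreySzpiro.Disproof

end
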